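import Summits.Ventures.HodgeRepro2.T5SU11UnipotentSubgroup

/-!
# The unipotent subgroup fixes the boundary point `1` and preserves the horocycles at `1`

The unipotent element `n_s = su11 (1 + i s) (-i s)` of `T5SU11UnipotentSubgroup` fixes the boundary point
`1` of the disc (`mobius_unip_one`), and on the disc it satisfies `1 - n_s · z = (1 - z) / (i s z + 1 - i s)`
(`one_sub_mobius_unip`). Together with the invariance of the Poincaré density
(`T5PoincareDensity.one_sub_normSq_mobius`: `1 - |g·z|² = (1 - |z|²)/|b̄ z + ā|²`) this gives the
INVARIANCE OF THE POISSON KERNEL at `1`: the function `P(z) = (1 - |z|²) / |1 - z|²` satisfies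
`P(n_s · z) = P(z)` for every `s` and every `z ∈ 𝔻` (`poisson_mobius_unip`). Its level sets
`{z ∈ 𝔻 : P(z) = c}` are the HOROCYCLES at `1`; hence `N` preserves every horocycle
(`horocycle_mobius_unip`), and the `N`-orbit of `0` lies on the horocycle `P = 1` through `0`
(`orbit_unip_mem_horocycle`). Nothing is claimed about (N).

Blind lane: Mathlib + the HodgeRepro2 prefix only; no sorry; axioms ⊆ {propext, Classical.choice,
Quot.sound}.
-/

namespace Summit.Ventures.HodgeRepro2.T5SU11Horocycle

open Metric Filter Topology Set Complex
open T5UnitaryBound T5PoincareDensity T5PoincareInvariance T5SU11Unimodular T5SU11Fibration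
  T5SU11Cartan T5SU11OneParameter T5BergmanCoefficient T5SU11UnipotentSubgroup

/-! ### The Möbius action of `n_s` -/

/-- The Möbius action of `n_s`: `n_s · w = ((1 + i s) w - i s) / (i s w + (1 - i s))`. -/
lemma mobius_unip (s : ℝ) (w : ℂ) :
    mobius (mat (unip s)) w =
      ((1 + (s : ℂ) * I) * w - (s : ℂ) * I) / ((s : ℂ) * I * w + (1 - (s : ℂ) * I)) := by
  rw [mat_unip, mobius_su11]
  simp only [map_neg, map_mul, map_add, map_one, Complex.conj_ofReal, Complex.conj_I]
  ring_nf

/-- The denominator of `n_s · z` for `z ∈ 𝔻` is non-zero. -/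
lemma denom_unip_ne_zero (s : ℝ) {z : ℂ} (hz : z ∈ ball (0 : ℂ) 1) :
    (s : ℂ) * I * z + (1 - (s : ℂ) * I) ≠ 0 := by
  have h := denom_ne_zero (normSq_one_add_mul_I_sub s) ((mem_ball_iff_normSq z).1 hz)
  simp only [map_neg, map_mul, map_add, map_one, Complex.conj_ofReal, Complex.conj_I] at h
  intro h0
  apply h
  rw [← h0]
  ring

/-- **`n_s` fixes the boundary point `1`**: `n_s · 1 = 1`. -/
theorem mobius_unip_one (s : ℝ) : mobius (mat (unip s)) 1 = 1 := by
  rw [mobius_unip]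
  have h : (s : ℂ) * I * 1 + (1 - (s : ℂ) * I) = 1 := by ring
  rw [h, div_one]
  ring

/-- `1 - n_s · z = (1 - z) / (i s z + (1 - i s))`. -/
theorem one_sub_mobius_unip (s : ℝ) {z : ℂ} (hz : z ∈ ball (0 : ℂ) 1) :
    1 - mobius (mat (unip s)) z = (1 - z) / ((s : ℂ) * I * z + (1 - (s : ℂ) * I)) := by
  rw [mobius_unip, eq_div_iff (denom_unip_ne_zero s hz), sub_mul,
    div_mul_cancel₀ _ (denom_unip_ne_zero s hz)]
  ring

/-- `1 - |n_s · z|² = (1 - |z|²) / |i s z + (1 - i s)|²`. -/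
theorem one_sub_normSq_mobius_unip (s : ℝ) {z : ℂ} (hz : z ∈ ball (0 : ℂ) 1) :
    1 - Complex.normSq (mobius (mat (unip s)) z) =
      (1 - Complex.normSq z) / Complex.normSq ((s : ℂ) * I * z + (1 - (s : ℂ) * I)) := by
  have h := one_sub_normSq_mobius (normSq_one_add_mul_I_sub s) ((mem_ball_iff_normSq z).1 hz)
  rw [← mat_unip] at h
  simp only [map_neg, map_mul, map_add, map_one, Complex.conj_ofReal, Complex.conj_I] at h
  rw [h]
  congr 2
  ring

/-! ### The Poisson kernel at `1` and the horocycles -/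

/-- The Poisson kernel at the boundary point `1`: `P(z) = (1 - |z|²) / |1 - z|²`. -/
noncomputable def poisson (z : ℂ) : ℝ := (1 - Complex.normSq z) / Complex.normSq (1 - z)

/-- `P(0) = 1`. -/
lemma poisson_zero : poisson 0 = 1 := by
  simp [poisson]

/-- **The Poisson kernel at `1` is `N`-invariant**: `P(n_s · z) = P(z)` for `z ∈ 𝔻`. -/
theorem poisson_mobius_unip (s : ℝ) {z : ℂ} (hz : z ∈ ball (0 : ℂ) 1) :
    poisson (mobius (mat (unip s)) z) = poisson z := by
  unfold poisson
  rw [one_sub_normSq_mobius_unip s hz, one_sub_mobius_unip s hz, Complex.normSq_div]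
  have hd : Complex.normSq ((s : ℂ) * I * z + (1 - (s : ℂ) * I)) ≠ 0 :=
    (Complex.normSq_pos.2 (denom_unip_ne_zero s hz)).ne'
  have h1 : z ≠ 1 := by
    rintro rfl
    have := mem_ball_zero_iff.mp hz
    simp at this
  have hz1 : Complex.normSq (1 - z) ≠ 0 := (Complex.normSq_pos.2 (sub_ne_zero.2 h1.symm)).ne'
  field_simp

/-- The horocycle at `1` of parameter `c`: `{z ∈ 𝔻 : P(z) = c}`. -/
def horocycle (c : ℝ) : Set ℂ := {z | z ∈ ball (0 : ℂ) 1 ∧ poisson z = c}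

/-- **`N` preserves every horocycle at `1`**: `z ∈ H_c ⇒ n_s · z ∈ H_c`. -/
theorem horocycle_mobius_unip (s : ℝ) {c : ℝ} {z : ℂ} (hz : z ∈ horocycle c) :
    mobius (mat (unip s)) z ∈ horocycle c :=
  ⟨mobius_mem_ball (unip s) hz.1, by rw [poisson_mobius_unip s hz.1, hz.2]⟩

/-- `0` lies on the horocycle `P = 1`. -/
lemma zero_mem_horocycle : (0 : ℂ) ∈ horocycle 1 :=
  ⟨mem_ball_self one_pos, poisson_zero⟩

/-- **The `N`-orbit of `0` lies on the horocycle `P = 1` through `0`**: `n_s · 0 ∈ H_1`. -/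
theorem orbit_unip_mem_horocycle (s : ℝ) : orbit (unip s) ∈ horocycle 1 :=
  horocycle_mobius_unip s zero_mem_horocycle

/-- The horocycles are the level sets of the `N`-invariant Poisson kernel: `P(n_s · 0) = 1`. -/
theorem poisson_orbit_unip (s : ℝ) : poisson (orbit (unip s)) = 1 :=
  (orbit_unip_mem_horocycle s).2

end Summit.Ventures.HodgeRepro2.T5SU11Horocycle
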